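import Summits.QuantumFields.YangMills.Theses.AllWindowsColdBox
import HarnessLib

/-!
# Route `AllWindowsColdBox` — glue item `BoxAllWindowsSU22OfWindows` (stmt-QuantumFields-24005), PROVED BY NAME

LINE-16 «one-scale cluster window» (planner ym-idea-2 g11; critic idea-crit-4 PASS 2026-08-29T02:27:34Z) splits the
open crux `BoxAllWindowsSU22` (22910) at the box exponent `θ = 1/16` into `BoxMidWindowsSU22` (24003, `θ ≤ 1/16`)
and `BoxHighWindowsSU22` (24004, `1/16 < θ`).  This file lands the case-split glue
`BoxMidWindowsSU22 → BoxHighWindowsSU22 → BoxAllWindowsSU22` (= the ideator's HOME `l16/Sketch.lean`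
`boxAllWindowsSU22_of_windows`, `rcases le_or_gt θ (1/16)`).

HONEST LABEL: 4-line plumbing; both window cruxes are OPEN; no rung (R2ξ″ is a RECORD label) and no summit is
proved; the Yang–Mills mass gap is NOT proved.  Width seat `ym-line-sfw-p2-w3` g33 (cell ym-idea-1, free hands).
-/

set_option autoImplicit false

namespace Summit.QuantumFields.YangMills.Theorems.AllWindowsColdBox

open Summit.QuantumFields.YangMills.Theses.AllWindowsColdBox

/-- **Glue `BoxAllWindowsSU22OfWindows` (stmt-QuantumFields-24005)**: the mid window (`θ ≤ 1/16`) and the high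
window (`1/16 < θ`) together give the parent `BoxAllWindowsSU22` — case split on `θ ≤ 1/16`. [folklore] -/
theorem boxAllWindowsSU22OfWindows_proof :
    Summit.QuantumFields.YangMills.Theses.AllWindowsColdBox.BoxAllWindowsSU22OfWindows := by
  intro hmid hhigh A θ hA hAθ hθ
  rcases le_or_gt θ (1 / 16) with h | h
  · exact hmid A θ hA hAθ hθ h
  · exact hhigh A θ hA hAθ hθ h

end Summit.QuantumFields.YangMills.Theorems.AllWindowsColdBox
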